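import Summits.HodgeConjecture.CorCM.D2Bridge.WeilFinRepMirror
import Summits.HodgeConjecture.CorCM.D2Bridge.AdapterWeilFinRepConj
import Literature.NumberTheory.Weil1964.AdelicMetaplecticRationalLiftConj
import Literature.NumberTheory.Weil1964.AdelicMetaplecticFinRepConj
import Literature.NumberTheory.GelbartRogawski1991.UnitaryDualPairWeilCoinvariants
import Literature.NumberTheory.GelbartRogawski1991.UnitaryDualPairSeesawSmallMajorants
import Literature.NumberTheory.GelbartRogawski1991.UnitaryDualPairSeesawContinuity
import HarnessLib

/-!
# FLOOR-0 P4, stub S5 (`stub_T3b_conjugatePartnerAt`), piece (J-a): the MIRROR LINE `W⁻ = (W, −⟨·,·⟩)` carries the COMPLEX-CONJUGATE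
# finite Weil representation — compatibility of the mirror splitting, the operator law, the conjugate-linear map of central coinvariants

Cell hodgecm-mathlib, crux item H413 = stmt-HodgeConjecture-24833, P4 line `Cruxes/H413/Lines/F0_P4AdmissibleOccursInH1.lean`, stub S5
`StubT3bConjugatePartnerAt` («a CONJUGATE-LINEAR bijection `J : ω_V(t) → ω_V(t')` intertwining `rho t` and `rho t'`; `J` = complex conjugation
of finite Schwartz functions»).  The pin's `ω_V(t)` is `TwistedCoinv.Coinv (finPairRepW … (JW a) … (hs a)) (lineChar a χ)`
(★ `Liu2021/Def411WeilCarriersAtLine` §1), so the kernel content of `J` is a statement about the finite Weil representation `finPairRep hs` of a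
finite-adelic unitary dual pair (★ `GelbartRogawski1991/UnitaryDualPairWeilCoinvariants`).  Proved here GENERICALLY (any quadratic datum, any
ranks `N, M`, any compatible pair splitting `s`), THEOREMS ONLY (no definition, no named fact, no `sorry`):
* §1–§3 **`isCompatible_mirrorSplitting`**: the mirror splitting `s̄ := mpCongr ∘ (·)ᶜ ∘ s ∘ (U(J_V ⊗ (−J_W)) = U(J_V ⊗ J_W))`
  (★ `HodgeCM.WeilCoinv.mirrorSplitting`, whose projection half ★ `proj_mirrorSplitting_eq_toSp` is in the tree) IS COMPATIBLE for the datum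
  of `(J_V, −J_W)` — rational half by ★ `Weil1964.adelicMpContConj_mem_range_ratSection` — and continuous when `s` is
  (`continuous_adelicMpContConj`: complex conjugation is continuous for the coefficient topology).
* §4 **the operator law** `ω(s̄_pair(g, ū)) Ψ = C (ω(s_pair(g, u)) (C Ψ))` (★ `adelicMpCont.omega_adelicMpContConj_apply`) and its finite factor
  **`finPairRep hs̄ (k, ū) f = C_f (finPairRep hs (k, u) (C_f f))`** (★ `AdapterWeil.finRepMp_eq_conj_of_omega_eq`; `ū = finAdelicNeg u`).
* §5 **`exists_coinv_semilinear_mirror`**: `C_f` descends to a BIJECTIVE conjugate-linear map of central coinvariants `Ω(s, χ) → Ω(s̄, χ')`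
  (`χ'(ū) = conj (χ u)`) intertwining `weilCoinv χ hs k` with `weilCoinv χ' hs̄ k` for the SAME `k ∈ U(J_V)(𝔸_f)` — the finite-adelic
  Schrödinger-conjugation half of S5's `J` (census A-p05 (g15) 2026-08-30T21:32:43Z, piece (i)).
NOT here: the identification of `s̄` for the pin's `ι_{μ}` at `⟨a⟩` with some `ι_{μ'}` at `⟨−a⟩`, `μ'` of weight one and complementary CM type
(central-type road ★ `Transposition/Item6CentralTypeAtPinConj`); `conj ∘ lineChar a χ = lineChar (−a) χ⁻¹`; the re-pointing `⟨−a⟩ ↦ ⟨r ε'⟩`.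
HC_CM is proved only modulo the printed citations until rung 0 closes; this file proves nothing about them.

References: [Li1992] J.-S. Li, J. reine angew. Math. 428 (1992), p. 181 («`ω*` is `ω_{ψ̄}`»); [MoeglinVignerasWaldspurger1987] LNM 1291,
Chap. 2 II.1, Chap. 3 IV; [GelbartRogawski1991] Invent. Math. 105 (1991), §3.1 Prop. 3.1.1 p. 455, Remark p. 457; [Kudla1994] Israel J. Math.
87, §1–§2 (`W⁻`); [Liu2021] Camb. J. Math. 9 (2021), Def. 4.11, App. D Lemma D.1 (2); [Weil1964] Acta Math. 111 (1964), Chap. III n° 37–41.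
-/

set_option autoImplicit false
set_option linter.dupNamespace false

noncomputable section

open scoped Matrix Kronecker TensorProduct ComplexConjugate
open NumberField NumberField.mixedEmbedding IsDedekindDomain
open Literature.RepresentationTheory Literature.RepresentationTheory.HeisenbergGroup
open Literature.NumberTheory.Automorphic Literature.NumberTheory.Automorphic.UnitaryGroup
open Literature.NumberTheory.Weil1964
open Literature.NumberTheory.GelbartRogawski1991 Literature.NumberTheory.GelbartRogawski1991.UnitaryDualPair
open Literature.NumberTheory.GelbartRogawski1991.UnitaryDualPair.WeilCoinv
open HodgeCM.WeilCoinv (mirrorSplitting mirrorSplitting_apply adelicGram_neg proj_mirrorSplitting_eq_toSp)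
open Summit.HodgeConjecture.CorCM.D2Bridge.AdapterWeil (finRepMp_eq_conj_of_omega_eq)

namespace Summit.HodgeConjecture.HodgeConjecture.Cruxes.H413.WeilFinRepMirror
/-! ## §1 Casts: `mpCongr` and `(·)ᶜ` preserve the rational section and are continuous -/
section Casts
variable {F : Type} [Field F] [NumberField F] {n : ℕ} {T T' : Matrix (Fin n) (Fin n) (AdeleRing (𝓞 F) F)}

/-- `mpCongr` (the identity re-typed along `T = T'`) carries the range of Weil's rational section of `Mp_ψ(W_T)` to that of
`Mp_ψ(W_{T'})`. [cite: MoeglinVignerasWaldspurger1987, Chap. 2 II.1] -/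
theorem mpCongr_mem_range_ratSection (h : T = T') (hT : IsUnit T.det) (hT' : IsUnit T'.det) {p : adelicMpCont F (Fin n) T}
    (hp : p ∈ (ratSection F T hT).range) : mpCongr h p ∈ (ratSection F T' hT').range := by
  subst h
  exact hp

/-- `mpCongr` is continuous (it is the identity). [cite: MoeglinVignerasWaldspurger1987, Chap. 2 II.1] -/
theorem continuous_mpCongr {ι : Type} [Fintype ι] [DecidableEq ι] {S S' : Matrix ι ι (AdeleRing (𝓞 F) F)} (h : S = S') :
    Continuous (mpCongr (F := F) h) := by
  subst h
  exact continuous_id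

/-- **complex conjugation `(g, M) ↦ (g, C M C)` is continuous** for the coefficient topologies of `Mp_ψ(W_T)ᶜᵒⁿᵗ` and
`Mp_ψ(W_{−T})ᶜᵒⁿᵗ`: the orbit maps of `π` do not move (`π(pᶜ) = π(p)`), the matrix coefficients move by `conj` and `Ψ ↦ Ψ̄`.
[cite: MoeglinVignerasWaldspurger1987, Chap. 2 II.1] -/
theorem continuous_adelicMpContConj {ι : Type} [Fintype ι] [DecidableEq ι] (S : Matrix ι ι (AdeleRing (𝓞 F) F)) :
    Continuous (adelicMpContConj F ι S) := by
  refine (continuous_into_adelicMpCont_iff _).2 ((continuous_into_adelicMp_iff _).2 ⟨fun w => ?_, fun Φ x => ?_⟩)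
  · have h : ∀ p : adelicMpCont F ι S,
        ((MpPsi.proj (adelicSchrodinger F ι (-S)) ((adelicMpContConj F ι S p : adelicMpCont F ι (-S)) : adelicMp F ι (-S)) :
            symplecticGroup (polar (adelicForm F ι (-S)))) :
          ((ι → AdeleRing (𝓞 F) F) × (ι → AdeleRing (𝓞 F) F)) ≃ₗ[AdeleRing (𝓞 F) F]
            ((ι → AdeleRing (𝓞 F) F) × (ι → AdeleRing (𝓞 F) F))) w =
        ((MpPsi.proj (adelicSchrodinger F ι S) (p : adelicMp F ι S) : symplecticGroup (polar (adelicForm F ι S))) :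
          ((ι → AdeleRing (𝓞 F) F) × (ι → AdeleRing (𝓞 F) F)) ≃ₗ[AdeleRing (𝓞 F) F]
            ((ι → AdeleRing (𝓞 F) F) × (ι → AdeleRing (𝓞 F) F))) w := fun p =>
      LinearEquiv.congr_fun (coe_proj_adelicMpConj (p : adelicMp F ι S)) w
    simp only [h]
    exact (continuous_proj_apply w).comp continuous_subtype_val
  · have h : ∀ p : adelicMpCont F ι S,
        ((omegaPsi (adelicSchrodinger F ι (-S)) ((adelicMpContConj F ι S p : adelicMpCont F ι (-S)) : adelicMp F ι (-S)) Φ :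
            piSchwartzBruhat F ι) : (ι → AdeleRing (𝓞 F) F) → ℂ) x =
        conj (((omegaPsi (adelicSchrodinger F ι S) (p : adelicMp F ι S) (piSchwartzBruhatConj F ι Φ) : piSchwartzBruhat F ι) :
          (ι → AdeleRing (𝓞 F) F) → ℂ) x) := fun p => by
      rw [coe_adelicMpContConj, omegaPsi_adelicMpConj_apply, piSchwartzBruhatConj_apply]
    simp only [h]
    exact Complex.continuous_conj.comp ((continuous_omegaPsi_apply _ x).comp continuous_subtype_val)
end Casts
/-! ## §2 Rational points: `G₁(F)` of `(J_V, −J_W)` is `G₁(F)` of `(J_V, J_W)` -/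
section Rational
variable (F E : Type) [Field F] [NumberField F] [Field E] [NumberField E] [Algebra F E]
variable (c : E ≃ₐ[F] E) (N M : ℕ) (JV : Matrix (Fin N) (Fin N) E) (JW : Matrix (Fin M) (Fin M) E)

omit [NumberField F] in
/-- **`G₁(F)` does not see the sign of `J_W`**: a rational point of `U(J_V ⊗ (−J_W))(𝔸)`, read in `U(J_V ⊗ J_W)(𝔸)` through the identity
of matrices, is a rational point. [cite: Kudla1994, §2] -/
theorem adelicPairNeg_symm_mem_range_rationalPairToAdelic {γ : adelicPair F E c N M JV (-JW)}
    (hγ : γ ∈ (rationalPairToAdelic F E c N M JV (-JW)).range) :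
    (adelicPairNeg F E c N M JV JW).symm γ ∈ (rationalPairToAdelic F E c N M JV JW).range := by
  obtain ⟨γ₀, rfl⟩ := hγ
  have hmem : (γ₀ : GL (Fin N × Fin M) E) ∈ rationalPair F E c N M JV JW := by
    have h := γ₀.2
    change (γ₀ : GL (Fin N × Fin M) E) ∈ unitaryGroupOfForm (c : E →+* E) (JV ⊗ₖ (-JW)) at h
    rw [kronecker_neg_right, Literature.NumberTheory.GelbartRogawski1991.GRConstruction.unitaryGroupOfForm_neg'] at h
    exact h
  refine ⟨⟨(γ₀ : GL (Fin N × Fin M) E), hmem⟩, Subtype.ext ?_⟩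
  have h3 := coe_adelicPairNeg_symm F E c N M JV JW (rationalPairToAdelic F E c N M JV (-JW) γ₀)
  rw [h3]
  exact Units.ext (by rw [coe_rationalPairToAdelic, coe_rationalPairToAdelic])
end Rational
/-! ## §3 The mirror splitting is compatible and continuous -/
section NegData
variable {F E : Type} [Field F] [Field E] [Algebra F E] {M : ℕ} {JW : Matrix (Fin M) (Fin M) E} {TW : Matrix (Fin M) (Fin M) F}

/-- the `(J_V, −J_W)` datum's hypotheses from those of `(J_V, J_W)`: `−T_W` is symmetric. [cite: Kudla1994, §2] -/
theorem isSymm_neg (hW : TW.IsSymm) : (-TW).IsSymm := hW.neg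

/-- … and `−J_W = (−T_W) ⊗ 1`. [cite: Kudla1994, §2] -/
theorem neg_eq_map_neg (hJW : JW = TW.map (algebraMap F E)) : -JW = (-TW).map (algebraMap F E) := by
  rw [hJW, Matrix.map_neg _ (map_neg (algebraMap F E))]

/-- … and `det (−T_W)` is a unit. [cite: Kudla1994, §2] -/
theorem isUnit_det_neg' (hWd : IsUnit TW.det) : IsUnit (-TW).det := by
  rw [Matrix.det_neg]
  exact (isUnit_one.neg.pow _).mul hWd
end NegData

section Compatible
variable (F E : Type) [Field F] [NumberField F] [Field E] [NumberField E] [Algebra F E]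
variable (c : E ≃ₐ[F] E) (N M : ℕ) {n : ℕ} (e : Fin N × Fin M ≃ Fin n)
variable (JV : Matrix (Fin N) (Fin N) E) (JW : Matrix (Fin M) (Fin M) E)
variable {TV : Matrix (Fin N) (Fin N) F} {TW : Matrix (Fin M) (Fin M) F}
variable [Algebra.IsQuadraticExtension F E] {δ : E} (hcδ : c δ = -δ) (hδ : δ ≠ 0) {d : F}
  (hd : δ * δ = algebraMap F E d) (hV : TV.IsSymm) (hW : TW.IsSymm) (hVd : IsUnit TV.det) (hWd : IsUnit TW.det)
  (hJV : JV = TV.map (algebraMap F E)) (hJW : JW = TW.map (algebraMap F E))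
  {s : adelicPair F E c N M JV JW →* adelicMpCont F (Fin n) (adelicGram F e TV TW)}

/-- **THE MIRROR SPLITTING IS COMPATIBLE** ([GelbartRogawski1991, Prop. 3.1.1] shape for the pair `(J_V, −J_W)`): `π ∘ s̄ = ι'`
(★ `proj_mirrorSplitting_eq_toSp`) and `s̄(G₁(F)) ⊆ i_{−}(Sp_F(W⁻))` — complex conjugation carries Weil's `Θ`-rigid rational section of
`Mp_ψ(W_T)` to that of `Mp_ψ(W_{−T})` (★ `adelicMpContConj_mem_range_ratSection`), and `G₁(F)` is the same set of matrices (§2).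
[cite: GelbartRogawski1991, §3.1 Prop. 3.1.1 p. 455 L1–3; Remark p. 457 L4] [cite: Weil1964, Chap. III n° 41 Thm 6 p. 193] -/
theorem isCompatible_mirrorSplitting (hs : (splittingDatum F E c N M e JV JW hcδ hδ hd hV hW hVd hWd hJV hJW).IsCompatible s) :
    (splittingDatum F E c N M e JV (-JW) hcδ hδ hd hV (isSymm_neg hW) hVd (isUnit_det_neg' hWd) hJV
        (neg_eq_map_neg hJW)).IsCompatible (mirrorSplitting F E c N M e JV JW s) := by
  refine HodgeCM.WeilCoinv.isCompatible_mirrorSplitting F E c N M e JV JW hcδ hδ hd hV hW hVd hWd hJV hJW hs (isSymm_neg hW)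
    (isUnit_det_neg' hWd) (neg_eq_map_neg hJW) fun γ hγ => ?_
  rw [mirrorSplitting_apply]
  exact mpCongr_mem_range_ratSection (adelicGram_neg F N M e TV TW).symm _ _
    (adelicMpContConj_mem_range_ratSection F (adelicGram F e TV TW) (isUnit_det_adelicGram F e hVd hWd)
      (hs.2 _ (adelicPairNeg_symm_mem_range_rationalPairToAdelic F E c N M JV JW hγ)))

omit [NumberField F] [Algebra.IsQuadraticExtension F E] in
/-- the identification `U(J_V ⊗ (−J_W))(𝔸) = U(J_V ⊗ J_W)(𝔸)` is continuous (same matrices, subtype topologies). [cite: Kudla1994, §2] -/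
theorem continuous_adelicPairNeg_symm : Continuous (adelicPairNeg F E c N M JV JW).symm :=
  continuous_induced_rng.2 (by
    have h : (fun g : adelicPair F E c N M JV (-JW) =>
        (((adelicPairNeg F E c N M JV JW).symm g : adelicPair F E c N M JV JW) : GL (Fin N × Fin M) (AdeleRing (𝓞 E) E))) =
        fun g : adelicPair F E c N M JV (-JW) => (g : GL (Fin N × Fin M) (AdeleRing (𝓞 E) E)) :=
      funext fun g => coe_adelicPairNeg_symm F E c N M JV JW g
    rw [Function.comp_def, h]
    exact continuous_subtype_val)

omit [Algebra.IsQuadraticExtension F E] in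
/-- **the mirror splitting is continuous when `s` is.** [cite: GelbartRogawski1991, §3.1 Prop. 3.1.1 p. 455 L1–3] -/
theorem continuous_mirrorSplitting (hsc : Continuous s) : Continuous (mirrorSplitting F E c N M e JV JW s) :=
  (continuous_mpCongr (adelicGram_neg F N M e TV TW).symm).comp
    ((continuous_adelicMpContConj (adelicGram F e TV TW)).comp (hsc.comp (continuous_adelicPairNeg_symm F E c N M JV JW)))
/-! ## §4 The operator law of the mirror splitting and its finite factor -/
omit [NumberField F] [Algebra.IsQuadraticExtension F E] in
/-- the pair embeddings do not see the sign of `J_W`: `(g ⊗ 1)·(1 ⊗ ū)` read back in `U(J_V ⊗ J_W)(𝔸)` is `(g ⊗ 1)·(1 ⊗ u)` when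
`ū` and `u` have the same matrix. [cite: Kudla1994, §2] -/
theorem adelicPairNeg_symm_inl_mul_inr (g : adelic F E c N JV) (u : adelic F E c M JW) (u' : adelic F E c M (-JW))
    (hu : ((u' : GL (Fin M) (AdeleRing (𝓞 E) E)) : Matrix (Fin M) (Fin M) (AdeleRing (𝓞 E) E)) = (u : GL (Fin M) (AdeleRing (𝓞 E) E))) :
    (adelicPairNeg F E c N M JV JW).symm (adelicInl F E c N M JV (-JW) g * adelicInr F E c N M JV (-JW) u') =
      adelicInl F E c N M JV JW g * adelicInr F E c N M JV JW u := by
  apply Subtype.ext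
  rw [coe_adelicPairNeg_symm, Subgroup.coe_mul, Subgroup.coe_mul]
  apply Units.ext
  rw [Units.val_mul, Units.val_mul, coe_adelicInl, coe_adelicInr, coe_adelicInl, coe_adelicInr, hu]

omit [Algebra.IsQuadraticExtension F E] in
/-- **THE OPERATOR LAW OF THE MIRROR SPLITTING**: `ω_{Gram(T_V,−T_W)}(s̄_pair(g, ū)) Ψ = C (ω_{Gram(T_V,T_W)}(s_pair(g, u)) (C Ψ))` —
the Weil operators of the mirror pair splitting are the complex conjugates of those of `s_pair` (`ū` = `u` read in `U(−J_W)(𝔸)`).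
[cite: Li1992, p. 181] [cite: MoeglinVignerasWaldspurger1987, Chap. 2 II.1] -/
theorem omega_pairSplitting_mirrorSplitting (g : adelic F E c N JV) (u : adelic F E c M JW) (u' : adelic F E c M (-JW))
    (hu : ((u' : GL (Fin M) (AdeleRing (𝓞 E) E)) : Matrix (Fin M) (Fin M) (AdeleRing (𝓞 E) E)) = (u : GL (Fin M) (AdeleRing (𝓞 E) E)))
    (Ψ : piSchwartzBruhat F (Fin n)) :
    adelicMpCont.omega F (Fin n) (adelicGram F e TV (-TW)) (pairSplitting F E c N M e JV (-JW) (mirrorSplitting F E c N M e JV JW s) (g, u')) Ψ =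
      piSchwartzBruhatConj F (Fin n)
        (adelicMpCont.omega F (Fin n) (adelicGram F e TV TW) (pairSplitting F E c N M e JV JW s (g, u)) (piSchwartzBruhatConj F (Fin n) Ψ)) := by
  -- no `rw` through the Weil operators (the `−T_W` instances make `kabstract` time out): a chain of `congrArg`s
  have h0 : pairSplitting F E c N M e JV (-JW) (mirrorSplitting F E c N M e JV JW s) (g, u') =
      mirrorSplitting F E c N M e JV JW s (adelicInl F E c N M JV (-JW) g * adelicInr F E c N M JV (-JW) u') := rfl
  have h1 : mirrorSplitting F E c N M e JV JW s (adelicInl F E c N M JV (-JW) g * adelicInr F E c N M JV (-JW) u') =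
      mpCongr (adelicGram_neg F N M e TV TW).symm
        (adelicMpContConj F (Fin n) (adelicGram F e TV TW) (s (adelicInl F E c N M JV JW g * adelicInr F E c N M JV JW u))) :=
    (mirrorSplitting_apply F E c N M e JV JW s _).trans
      (congrArg (fun x => mpCongr (adelicGram_neg F N M e TV TW).symm (adelicMpContConj F (Fin n) (adelicGram F e TV TW) (s x)))
        (adelicPairNeg_symm_inl_mul_inr F E c N M JV JW g u u' hu))
  have h2 : pairSplitting F E c N M e JV JW s (g, u) = s (adelicInl F E c N M JV JW g * adelicInr F E c N M JV JW u) := rfl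
  exact (congrArg (fun q => adelicMpCont.omega F (Fin n) (adelicGram F e TV (-TW)) q Ψ) (h0.trans h1)).trans
    ((adelicMpCont.omega_mpCongr_apply _ _ Ψ).trans
      ((adelicMpCont.omega_adelicMpContConj_apply _ Ψ).trans
        (congrArg (fun q => piSchwartzBruhatConj F (Fin n)
          (adelicMpCont.omega F (Fin n) (adelicGram F e TV TW) q (piSchwartzBruhatConj F (Fin n) Ψ))) h2.symm)))

omit [Algebra.IsQuadraticExtension F E] in
/-- the same law for `pairRep`: `(ω ∘ s̄_pair)(g, ū) Ψ = C ((ω ∘ s_pair)(g, u) (C Ψ))`. [cite: Li1992, p. 181] -/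
theorem pairRep_mirrorSplitting (g : adelic F E c N JV) (u : adelic F E c M JW) (u' : adelic F E c M (-JW))
    (hu : ((u' : GL (Fin M) (AdeleRing (𝓞 E) E)) : Matrix (Fin M) (Fin M) (AdeleRing (𝓞 E) E)) = (u : GL (Fin M) (AdeleRing (𝓞 E) E)))
    (Ψ : piSchwartzBruhat F (Fin n)) :
    pairRep F E c N M e JV (-JW) (mirrorSplitting F E c N M e JV JW s) (g, u') Ψ =
      piSchwartzBruhatConj F (Fin n) (pairRep F E c N M e JV JW s (g, u) (piSchwartzBruhatConj F (Fin n) Ψ)) :=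
  omega_pairSplitting_mirrorSplitting F E c N M e JV JW g u u' hu Ψ

omit [Algebra.IsQuadraticExtension F E] in
/-- the finite-adelic points: `ū := finAdelicNeg u` read in `U(−J_W)(𝔸)` has the matrix of `u` read in `U(J_W)(𝔸)`. [cite: Kudla1994, §2] -/
theorem val_finAdelicToAdelic_finAdelicNeg (u : finAdelic F E c M JW) :
    (((finAdelicToAdelic F E c M (-JW) (finAdelicNeg F E c M JW u)).1 : GL (Fin M) (AdeleRing (𝓞 E) E)) :
        Matrix (Fin M) (Fin M) (AdeleRing (𝓞 E) E)) =
      ((finAdelicToAdelic F E c M JW u).1 : GL (Fin M) (AdeleRing (𝓞 E) E)) := by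
  -- through the named unfoldings (a bare `rfl` is too deep for the kernel on adelic matrices)
  have h1 := adelicVal_finAdelicToAdelic F E c M (-JW) (finAdelicNeg F E c M JW u)
  have h2 := adelicVal_finAdelicToAdelic F E c M JW u
  rw [adelicVal_apply, coe_finAdelicNeg] at h1
  rw [adelicVal_apply] at h2
  exact congrArg (fun g : GL (Fin M) (AdeleRing (𝓞 E) E) => (g : Matrix (Fin M) (Fin M) (AdeleRing (𝓞 E) E))) (h1.trans h2.symm)

omit [Algebra.IsQuadraticExtension F E] in
/-- unfolding `(pairSmall₁ s̄ ∘ finPairToAdelic) (k, ū) = pairSmall₁ s̄ (k̂, ū̂)`. [cite: Weil1964, Chap. III n° 37–38 p. 188–190] -/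
theorem pairSmall₁_comp_finPairToAdelic_apply_neg (p : finAdelic F E c N JV × finAdelic F E c M JW) :
    ((pairSmall₁ F E c N M e JV (-JW) (mirrorSplitting F E c N M e JV JW s)).comp (finPairToAdelic F E c N M JV (-JW)))
        (p.1, finAdelicNeg F E c M JW p.2) =
      pairSmall₁ F E c N M e JV (-JW) (mirrorSplitting F E c N M e JV JW s)
        (finAdelicToAdelic F E c N JV p.1, finAdelicToAdelic F E c M (-JW) (finAdelicNeg F E c M JW p.2)) :=
  rfl

omit [Algebra.IsQuadraticExtension F E] in
/-- unfolding `(pairSmall₁ s ∘ finPairToAdelic) (k, u) = pairSmall₁ s (k̂, û)`. [cite: Weil1964, Chap. III n° 37–38 p. 188–190] -/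
theorem pairSmall₁_comp_finPairToAdelic_apply (p : finAdelic F E c N JV × finAdelic F E c M JW) :
    ((pairSmall₁ F E c N M e JV JW s).comp (finPairToAdelic F E c N M JV JW)) p =
      pairSmall₁ F E c N M e JV JW s (finAdelicToAdelic F E c N JV p.1, finAdelicToAdelic F E c M JW p.2) :=
  rfl

omit [Algebra.IsQuadraticExtension F E] in
set_option maxHeartbeats 800000 in
/-- the operator law in the Kronecker currency at the finite-adelic points (the hypothesis `hψ` of ★ `finRepMp_eq_conj_of_omega_eq`).
[cite: Weil1964, Chap. III n° 37–38 p. 188–190] [cite: Li1992, p. 181] -/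
theorem omega_pairSmall₁_mirrorSplitting_finPairToAdelic (p : finAdelic F E c N JV × finAdelic F E c M JW)
    (Ψ : piSchwartzBruhat F (Fin N × Fin M)) :
    adelicMpCont.omega F (Fin N × Fin M) (TV.map (algebraMap F (AdeleRing (𝓞 F) F)) ⊗ₖ (-TW).map (algebraMap F (AdeleRing (𝓞 F) F)))
        (((pairSmall₁ F E c N M e JV (-JW) (mirrorSplitting F E c N M e JV JW s)).comp (finPairToAdelic F E c N M JV (-JW)))
          (p.1, finAdelicNeg F E c M JW p.2)) Ψ =
      piSchwartzBruhatConj F (Fin N × Fin M)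
        (adelicMpCont.omega F (Fin N × Fin M) (TV.map (algebraMap F (AdeleRing (𝓞 F) F)) ⊗ₖ TW.map (algebraMap F (AdeleRing (𝓞 F) F)))
          (((pairSmall₁ F E c N M e JV JW s).comp (finPairToAdelic F E c N M JV JW)) p) (piSchwartzBruhatConj F (Fin N × Fin M) Ψ)) := by
  -- both sides through `ω(pairSmall₁ · p) Φ = R_e⁻¹ (pairRep · p (R_e Φ))`, then §4's law and `C R_e = R_e C`; no `rw` (`−T_W` in motives)
  have h0 := congrArg (fun q => adelicMpCont.omega F (Fin N × Fin M)
      (TV.map (algebraMap F (AdeleRing (𝓞 F) F)) ⊗ₖ (-TW).map (algebraMap F (AdeleRing (𝓞 F) F))) q Ψ)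
    (pairSmall₁_comp_finPairToAdelic_apply_neg F E c N M e JV JW (s := s) p)
  have hL := omega_pairSmall₁_apply F E c N M e JV (-JW) (mirrorSplitting F E c N M e JV JW s)
    (finAdelicToAdelic F E c N JV p.1, finAdelicToAdelic F E c M (-JW) (finAdelicNeg F E c M JW p.2)) Ψ
  have hlaw := pairRep_mirrorSplitting F E c N M e JV JW (s := s) (finAdelicToAdelic F E c N JV p.1) (finAdelicToAdelic F E c M JW p.2)
    (finAdelicToAdelic F E c M (-JW) (finAdelicNeg F E c M JW p.2)) (val_finAdelicToAdelic_finAdelicNeg F E c M JW p.2)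
    (piSBReindex F e Ψ)
  have hC := congrArg (fun X => (piSBReindex F e).symm (piSchwartzBruhatConj F (Fin n)
      (pairRep F E c N M e JV JW s (finAdelicToAdelic F E c N JV p.1, finAdelicToAdelic F E c M JW p.2) X)))
    (piSchwartzBruhatConj_piSBReindex e Ψ)
  have hR := omega_pairSmall₁_apply F E c N M e JV JW s (finAdelicToAdelic F E c N JV p.1, finAdelicToAdelic F E c M JW p.2)
    (piSchwartzBruhatConj F (Fin N × Fin M) Ψ)
  have h9 := congrArg (fun q => piSchwartzBruhatConj F (Fin N × Fin M) (adelicMpCont.omega F (Fin N × Fin M)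
      (TV.map (algebraMap F (AdeleRing (𝓞 F) F)) ⊗ₖ TW.map (algebraMap F (AdeleRing (𝓞 F) F))) q (piSchwartzBruhatConj F (Fin N × Fin M) Ψ)))
    (pairSmall₁_comp_finPairToAdelic_apply F E c N M e JV JW (s := s) p)
  exact h0.trans (hL.trans ((congrArg (piSBReindex F e).symm hlaw).trans (hC.trans
    ((piSchwartzBruhatConj_piSBReindex_symm e _).symm.trans ((congrArg (piSchwartzBruhatConj F (Fin N × Fin M)) hR.symm).trans h9.symm)))))

/-- **THE FINITE FACTOR OF THE MIRROR SPLITTING IS THE CONJUGATE FINITE WEIL REPRESENTATION**: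
`ω_f(s̄)(k, ū) f = C_f (ω_f(s)(k, u) (C_f f))` on `𝒮((𝔸_F^∞)^{N·M})` — [Liu2021, Lem. D.1 (2)]'s «`\overline{ω(μ,ε)} = ω` on the negated
line» before passing to `χ`-coinvariants. [cite: Li1992, p. 181] [cite: Liu2021, App. D Lemma D.1 (2) (l. 5231)]
[cite: Weil1964, Chap. III n° 37–38 p. 188–190] -/
theorem finPairRep_mirrorSplitting (hs : (splittingDatum F E c N M e JV JW hcδ hδ hd hV hW hVd hWd hJV hJW).IsCompatible s)
    (k : finAdelic F E c N JV) (u : finAdelic F E c M JW) (f : FinSB F (Fin N × Fin M)) :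
    finPairRep F E c N M e JV (-JW) hcδ hδ hd hV (isSymm_neg hW) hVd (isUnit_det_neg' hWd) hJV (neg_eq_map_neg hJW)
        (isCompatible_mirrorSplitting F E c N M e JV JW hcδ hδ hd hV hW hVd hWd hJV hJW hs) (k, finAdelicNeg F E c M JW u) f =
      finSBConj (finPairRep F E c N M e JV JW hcδ hδ hd hV hW hVd hWd hJV hJW hs (k, u) (finSBConj f)) :=
  finRepMp_eq_conj_of_omega_eq (isUnit_kronecker_map F N hVd hWd) (isUnit_kronecker_map F N hVd (isUnit_det_neg' hWd))
    ((pairSmall₁ F E c N M e JV JW s).comp (finPairToAdelic F E c N M JV JW))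
    ((pairSmall₁ F E c N M e JV (-JW) (mirrorSplitting F E c N M e JV JW s)).comp (finPairToAdelic F E c N M JV (-JW)))
    (fun p a w => proj_pairSmall₁_finAdelic_apply_archVec F E c N M e JV JW hcδ hδ hd hV hW hVd hWd hJV hJW hs p.1 p.2 a w)
    (fun p a w => proj_pairSmall₁_finAdelic_apply_archVec F E c N M e JV (-JW) hcδ hδ hd hV (isSymm_neg hW) hVd (isUnit_det_neg' hWd)
      hJV (neg_eq_map_neg hJW) (isCompatible_mirrorSplitting F E c N M e JV JW hcδ hδ hd hV hW hVd hWd hJV hJW hs) p.1 p.2 a w)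
    (fun p => (p.1, finAdelicNeg F E c M JW p.2))
    (fun p Ψ => omega_pairSmall₁_mirrorSplitting_finPairToAdelic F E c N M e JV JW p Ψ) (k, u) f

/-- the `W`-member alone: `finPairRepW hs̄ ū (C_f f) = C_f (finPairRepW hs u f)`. [cite: Li1992, p. 181] -/
theorem finPairRepW_mirrorSplitting_finSBConj (hs : (splittingDatum F E c N M e JV JW hcδ hδ hd hV hW hVd hWd hJV hJW).IsCompatible s)
    (u : finAdelic F E c M JW) (f : FinSB F (Fin N × Fin M)) :
    finPairRepW F E c N M e JV (-JW) hcδ hδ hd hV (isSymm_neg hW) hVd (isUnit_det_neg' hWd) hJV (neg_eq_map_neg hJW)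
        (isCompatible_mirrorSplitting F E c N M e JV JW hcδ hδ hd hV hW hVd hWd hJV hJW hs) (finAdelicNeg F E c M JW u) (finSBConj f) =
      finSBConj (finPairRepW F E c N M e JV JW hcδ hδ hd hV hW hVd hWd hJV hJW hs u f) := by
  rw [finPairRepW_apply, finPairRepW_apply, finPairRep_mirrorSplitting, finSBConj_finSBConj]

/-- the `V`-member alone: `finPairRepV hs̄ k (C_f f) = C_f (finPairRepV hs k f)` — SAME `k`. [cite: Li1992, p. 181] -/
theorem finPairRepV_mirrorSplitting_finSBConj (hs : (splittingDatum F E c N M e JV JW hcδ hδ hd hV hW hVd hWd hJV hJW).IsCompatible s)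
    (k : finAdelic F E c N JV) (f : FinSB F (Fin N × Fin M)) :
    finPairRepV F E c N M e JV (-JW) hcδ hδ hd hV (isSymm_neg hW) hVd (isUnit_det_neg' hWd) hJV (neg_eq_map_neg hJW)
        (isCompatible_mirrorSplitting F E c N M e JV JW hcδ hδ hd hV hW hVd hWd hJV hJW hs) k (finSBConj f) =
      finSBConj (finPairRepV F E c N M e JV JW hcδ hδ hd hV hW hVd hWd hJV hJW hs k f) := by
  rw [finPairRepV_apply, finPairRepV_apply, ← map_one (finAdelicNeg F E c M JW), finPairRep_mirrorSplitting, finSBConj_finSBConj]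
/-! ## §5 Complex conjugation descends to the central coinvariants -/
/-- the relation submodule of `(ω_f(s)|_W, χ)` is carried by `C_f` into that of `(ω_f(s̄)|_{W⁻}, χ')` whenever `χ'(ū) = conj (χ u)`.
[cite: Liu2021, App. D §D.1 Step 3 (l. 5219); Lemma D.1 (2) (l. 5231)] -/
theorem ker_le_comap_finSBConj (hs : (splittingDatum F E c N M e JV JW hcδ hδ hd hV hW hVd hWd hJV hJW).IsCompatible s)
    (χ : finAdelic F E c M JW →* ℂˣ) (χ' : finAdelic F E c M (-JW) →* ℂˣ)
    (hχ' : ∀ u, ((χ' (finAdelicNeg F E c M JW u) : ℂˣ) : ℂ) = conj ((χ u : ℂˣ) : ℂ)) :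
    TwistedCoinv.ker (finPairRepW F E c N M e JV JW hcδ hδ hd hV hW hVd hWd hJV hJW hs) χ ≤
      (TwistedCoinv.ker (finPairRepW F E c N M e JV (-JW) hcδ hδ hd hV (isSymm_neg hW) hVd (isUnit_det_neg' hWd) hJV (neg_eq_map_neg hJW)
          (isCompatible_mirrorSplitting F E c N M e JV JW hcδ hδ hd hV hW hVd hWd hJV hJW hs)) χ').comap
        (finSBConjₛₗ : FinSB F (Fin N × Fin M) ≃ₛₗ[starRingEnd ℂ] FinSB F (Fin N × Fin M)).toLinearMap := by
  rw [TwistedCoinv.ker, Submodule.span_le]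
  rintro _ ⟨⟨u, v⟩, rfl⟩
  rw [SetLike.mem_coe, Submodule.mem_comap, LinearEquiv.coe_toLinearMap, map_sub, LinearEquiv.map_smulₛₗ, finSBConjₛₗ_apply,
    finSBConjₛₗ_apply, ← finPairRepW_mirrorSplitting_finSBConj F E c N M e JV JW hcδ hδ hd hV hW hVd hWd hJV hJW hs u v, ← hχ' u]
  exact TwistedCoinv.sub_mem_ker _ χ' _ _

/-- … and conversely (`C_f` is an involution and `conj (χ' ū) = χ u`). [cite: Liu2021, App. D §D.1 Step 3 (l. 5219)] -/
theorem ker_le_comap_finSBConj_symm (hs : (splittingDatum F E c N M e JV JW hcδ hδ hd hV hW hVd hWd hJV hJW).IsCompatible s)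
    (χ : finAdelic F E c M JW →* ℂˣ) (χ' : finAdelic F E c M (-JW) →* ℂˣ)
    (hχ' : ∀ u, ((χ' (finAdelicNeg F E c M JW u) : ℂˣ) : ℂ) = conj ((χ u : ℂˣ) : ℂ)) :
    TwistedCoinv.ker (finPairRepW F E c N M e JV (-JW) hcδ hδ hd hV (isSymm_neg hW) hVd (isUnit_det_neg' hWd) hJV (neg_eq_map_neg hJW)
          (isCompatible_mirrorSplitting F E c N M e JV JW hcδ hδ hd hV hW hVd hWd hJV hJW hs)) χ' ≤
      (TwistedCoinv.ker (finPairRepW F E c N M e JV JW hcδ hδ hd hV hW hVd hWd hJV hJW hs) χ).comap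
        (finSBConjₛₗ : FinSB F (Fin N × Fin M) ≃ₛₗ[starRingEnd ℂ] FinSB F (Fin N × Fin M)).toLinearMap := by
  rw [TwistedCoinv.ker, Submodule.span_le]
  rintro _ ⟨⟨u', w⟩, rfl⟩
  obtain ⟨u, rfl⟩ : ∃ u, finAdelicNeg F E c M JW u = u' := ⟨(finAdelicNeg F E c M JW).symm u', MulEquiv.apply_symm_apply _ _⟩
  have key : finPairRepW F E c N M e JV (-JW) hcδ hδ hd hV (isSymm_neg hW) hVd (isUnit_det_neg' hWd) hJV (neg_eq_map_neg hJW)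
        (isCompatible_mirrorSplitting F E c N M e JV JW hcδ hδ hd hV hW hVd hWd hJV hJW hs) (finAdelicNeg F E c M JW u) w =
      finSBConj (finPairRepW F E c N M e JV JW hcδ hδ hd hV hW hVd hWd hJV hJW hs u (finSBConj w)) := by
    have h := finPairRepW_mirrorSplitting_finSBConj F E c N M e JV JW hcδ hδ hd hV hW hVd hWd hJV hJW hs u (finSBConj w)
    rwa [finSBConj_finSBConj] at h
  rw [SetLike.mem_coe, Submodule.mem_comap, LinearEquiv.coe_toLinearMap, map_sub, LinearEquiv.map_smulₛₗ, finSBConjₛₗ_apply,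
    finSBConjₛₗ_apply, hχ', Complex.conj_conj, key, finSBConj_finSBConj]
  exact TwistedCoinv.sub_mem_ker _ χ u (finSBConj w)

/-- **COMPLEX CONJUGATION DESCENDS TO THE CENTRAL COINVARIANTS — the finite-adelic half of S5's `J`**: for a compatible pair
splitting `s` at `(J_V, J_W)`, its mirror `s̄` at `(J_V, −J_W)`, a character `χ` of `U(J_W)(𝔸_f)` and the character `χ'` of
`U(−J_W)(𝔸_f)` with `χ'(ū) = conj (χ u)`, there is a CONJUGATE-LINEAR BIJECTION `J : Ω(s, χ) → Ω(s̄, χ')`, `J [f] = [C_f f]`, intertwining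
the `U(J_V)(𝔸_f)`-actions AT THE SAME GROUP ELEMENT: `J (Ω(s,χ)(k) x) = Ω(s̄,χ')(k) (J x)` — «`ω_V(t') ≅ \overline{ω_V(t)}`» at the level
of [Liu2021, App. D §D.1 Step 3]'s maximal `χ`-quotients. [cite: Liu2021, Def. 4.11 (l. 2092–2096); App. D Lemma D.1 (2) (l. 5231)]
[cite: Li1992, p. 181] [cite: MoeglinVignerasWaldspurger1987, Chap. 3 IV] -/
theorem exists_coinv_semilinear_mirror (hs : (splittingDatum F E c N M e JV JW hcδ hδ hd hV hW hVd hWd hJV hJW).IsCompatible s)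
    (χ : finAdelic F E c M JW →* ℂˣ) (χ' : finAdelic F E c M (-JW) →* ℂˣ)
    (hχ' : ∀ u, ((χ' (finAdelicNeg F E c M JW u) : ℂˣ) : ℂ) = conj ((χ u : ℂˣ) : ℂ)) :
    ∃ J : TwistedCoinv.Coinv (finPairRepW F E c N M e JV JW hcδ hδ hd hV hW hVd hWd hJV hJW hs) χ →ₛₗ[starRingEnd ℂ]
        TwistedCoinv.Coinv (finPairRepW F E c N M e JV (-JW) hcδ hδ hd hV (isSymm_neg hW) hVd (isUnit_det_neg' hWd) hJV
          (neg_eq_map_neg hJW) (isCompatible_mirrorSplitting F E c N M e JV JW hcδ hδ hd hV hW hVd hWd hJV hJW hs)) χ',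
      Function.Bijective J ∧
      (∀ f, J (TwistedCoinv.mk _ χ f) = TwistedCoinv.mk _ χ' (finSBConj f)) ∧
      ∀ (k : finAdelic F E c N JV) (x : TwistedCoinv.Coinv (finPairRepW F E c N M e JV JW hcδ hδ hd hV hW hVd hWd hJV hJW hs) χ),
        J (weilCoinv F E c N M e JV JW hcδ hδ hd hV hW hVd hWd hJV hJW χ hs k x) =
          weilCoinv F E c N M e JV (-JW) hcδ hδ hd hV (isSymm_neg hW) hVd (isUnit_det_neg' hWd) hJV (neg_eq_map_neg hJW) χ'
            (isCompatible_mirrorSplitting F E c N M e JV JW hcδ hδ hd hV hW hVd hWd hJV hJW hs) k (J x) := by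
  let J := Submodule.mapQ _ _ (finSBConjₛₗ : FinSB F (Fin N × Fin M) ≃ₛₗ[starRingEnd ℂ] FinSB F (Fin N × Fin M)).toLinearMap
    (ker_le_comap_finSBConj F E c N M e JV JW hcδ hδ hd hV hW hVd hWd hJV hJW hs χ χ' hχ')
  let J' := Submodule.mapQ _ _ (finSBConjₛₗ : FinSB F (Fin N × Fin M) ≃ₛₗ[starRingEnd ℂ] FinSB F (Fin N × Fin M)).toLinearMap
    (ker_le_comap_finSBConj_symm F E c N M e JV JW hcδ hδ hd hV hW hVd hWd hJV hJW hs χ χ' hχ')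
  have hJ : ∀ f, J (TwistedCoinv.mk _ χ f) = TwistedCoinv.mk _ χ' (finSBConj f) := fun f => rfl
  have hJ' : ∀ f, J' (TwistedCoinv.mk _ χ' f) = TwistedCoinv.mk _ χ (finSBConj f) := fun f => rfl
  refine ⟨J, ⟨fun x y hxy => ?_, fun y => ?_⟩, hJ, fun k x => ?_⟩
  · obtain ⟨v, rfl⟩ := TwistedCoinv.mk_surjective _ χ x
    obtain ⟨w, rfl⟩ := TwistedCoinv.mk_surjective _ χ y
    have h := congrArg J' hxy
    rw [hJ, hJ, hJ', hJ', finSBConj_finSBConj, finSBConj_finSBConj] at h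
    exact h
  · obtain ⟨w, rfl⟩ := TwistedCoinv.mk_surjective _ χ' y
    exact ⟨TwistedCoinv.mk _ χ (finSBConj w), by rw [hJ, finSBConj_finSBConj]⟩
  · obtain ⟨v, rfl⟩ := TwistedCoinv.mk_surjective _ χ x
    have key : finPairRep F E c N M e JV (-JW) hcδ hδ hd hV (isSymm_neg hW) hVd (isUnit_det_neg' hWd) hJV (neg_eq_map_neg hJW)
          (isCompatible_mirrorSplitting F E c N M e JV JW hcδ hδ hd hV hW hVd hWd hJV hJW hs) (k, 1) (finSBConj v) =
        finSBConj (finPairRep F E c N M e JV JW hcδ hδ hd hV hW hVd hWd hJV hJW hs (k, 1) v) := by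
      have h := finPairRep_mirrorSplitting F E c N M e JV JW hcδ hδ hd hV hW hVd hWd hJV hJW hs k 1 (finSBConj v)
      rwa [map_one, finSBConj_finSBConj] at h
    rw [weilCoinv_mk, hJ, hJ, weilCoinv_mk, key]
end Compatible
end Summit.HodgeConjecture.HodgeConjecture.Cruxes.H413.WeilFinRepMirror

end
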